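import Summits.BirchSwinnertonDyer.Rank1Residual.X2.GreenbergVatsalTateDatum
import Literature.NumberTheory.EllipticCurves.TateParametrisationTorsion
import Literature.NumberTheory.EllipticCurves.IwasawaTowerTorsionProofs
import Literature.NumberTheory.GaloisRepresentations.LocalKroneckerWeberInertiaProofs
import Literature.NumberTheory.GaloisRepresentations.DecompositionGroupOfCompletion
import HarnessLib

/-!
# The Tate datum of `E/ℚ` at an odd `p ‖ N`, part II: `C[p] = Φ(μ_p)` is MOVED by the inertia group
# (`hgen`), and `E(ℚ_∞)[p^∞] = E(ℚ)[p^∞]` is FINITE for the cyclotomic `ℤ_p`-extension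
# (Mazur's Prop. 6.12 / Greenberg LNM 1716 p. 62 at a Tate prime) — relative to a Tate parametrisation

HONEST FRAMING (cell `b2b-bsdres`, run/shared/lean/b2b/bsd-rank1-residual/, verbatim in every
file): the goal of the cell is to DELETE the COMBINATION-SHAPED residual classes of the
Birch–Swinnerton-Dyer formula for ALL analytic-rank `≤ 1` elliptic curves over `ℚ` — "full BSD
formula for every rank `≤ 1` curve in class `C`" assembled STRICTLY from published theorems — so
that the rank-`≤ 1` remainder becomes exactly the CONSTRUCTION-SHAPED classes, which are TYPED
(missing-input `Prop`s), NOT attempted. This is not "finishing BSD". Sub-cell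
`b2b-bsdres-eisenstein-p2` (CLASS-OWNERS row "X2"), gen 9: research route; NO CLAIM BEYOND STATED
CLASSES; nothing here changes a label. Theorems only (no `def`, no named fact); the Tate
parametrisation `Φ` (kernel `q^ℤ`, `0 < |q|_v < 1`, surjective, equivariant up to sign, equivariant on
the inertia group) enters as explicit hypotheses, so nothing here is conditional.

WHAT THIS FILE PROVES (for `E/ℚ`, `p` ODD, `v ∋ p`, and the Tate datum `C_v = ι⁻¹Φ(μ)` of
`GreenbergVatsalTateDatum`) — the two inputs of the kernel comparison/transfer that were still
displayed for the MULTIPLICATIVE member of a route-G pair (X2-GAP §14.6 "NET"):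
* `exists_pow_eq_one_of_mem`, `smul_eq_nsmul_of_cyclotomicCharacter_eq` — `C[p] = Φ(μ_p)` and the
  local inertia group acts on it through the mod-`p` cyclotomic character (`σ ↦ χ_p(σ) mod p`;
  GV p. 14 "`C ≅ μ_{p^∞}`"); `exists_mem_absInertia_cyclotomicCharacter_eq_natCast` —
  `χ_p(I_{ℚ_v}) ∋ N` for `p ∤ N` (local Kronecker–Weber, tree
  `adicCompletion_rat_exists_mem_absInertia_cyclotomicCharacter_eq`);
* **`tateDatum_hgen`** — the inertia group MOVES every point of `C[p]` (`σ₀` with `χ_p(σ₀) = 2`):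
  hypothesis `hgen` of `GreenbergVatsalTorsionInvariants.natCard_gvSelmer_inf_torsion_eq_of_inertia`;
* **`smul_eq_of_mem_fixedPoints_kerSubgroup`**, **`finite_fixedPoints_kerSubgroup`** —
  `E(ℚ_∞)[p^∞] = E(ℚ)[p^∞]`, FINITE, for the cyclotomic `ℤ_p`-extension: the argument of the tree's
  `IwasawaTowerTorsionOrdinaryProofs` (Serre's ordinary line) run on the TATE line — an inertia
  element with `χ_p = p − 1` acts as `−1` on `B[p] ∩ C` while `Γ_ℚ` acts on the finite `B[p]`
  through a `p`-group (`ZpExtension.isPGroup_range_of_kerSubgroup_le`), so `B ∩ C = 0`; `τb − b ∈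
  B ∩ C` for `τ` in the inertia group (`tateDatum_htriv`); `Γ_ℚ = I_𝔓·ker κ` (total ramification,
  `ZpExtension.IsCyclotomic.exists_mem_inertia_inv_mul_mem_kerSubgroup` with
  `inertia_adicCompletionPrime_eq_map_absInertia`). This is the hypothesis `[Finite (invariants H M)]`
  of every comparison theorem, now available at `p ‖ N` (GV p. 26: "`E(ℚ_∞)_{tors}` is known to be
  finite") — previously a tree theorem only at good ordinary `p`.

References: Greenberg–Vatsal 2000, §2 pp. 14–15, 26; Greenberg, LNM 1716, §1 p. 62, §3 p. 86;
Mazur 1972 Prop. 6.12; Serre, *Local Fields* IV §4 Prop. 17; Silverman *ATAEC* V Thm. 3.1.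
-/

noncomputable section

open scoped Classical AddSubgroup NNReal

open NumberField IsDedekindDomain Field
open Literature.NumberTheory.EllipticCurves Literature.NumberTheory.EllipticCurves.GreenbergSelmer
  Literature.NumberTheory.GaloisRepresentations IsDedekindDomain.HeightOneSpectrum
  Summit.BirchSwinnertonDyer.Rank1Residual.X2.GreenbergVatsalTorsion
  Summit.BirchSwinnertonDyer.Rank1Residual.X2.GreenbergVatsalTateDatum

namespace Summit.BirchSwinnertonDyer.Rank1Residual.X2.GreenbergVatsalTateDatumTorsion

variable (W : WeierstrassCurve ℚ) [W.IsElliptic] (p : ℕ) [hp : Fact p.Prime]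
  {v : HeightOneSpectrum (𝓞 ℚ)}
  (Φ : Additive (AlgebraicClosure (v.adicCompletion ℚ))ˣ →+ localPoints W (v.adicCompletion ℚ))
  (hΦ : ∀ (σ : absoluteGaloisGroup (v.adicCompletion ℚ))
    (u : (AlgebraicClosure (v.adicCompletion ℚ))ˣ),
    σ • Φ (Additive.ofMul u) = Φ (Additive.ofMul (Units.map
      (Field.absoluteGaloisGroup.toAlgEquiv (v.adicCompletion ℚ) σ :
        AlgebraicClosure (v.adicCompletion ℚ) →* AlgebraicClosure (v.adicCompletion ℚ)) u)) ∨
    σ • Φ (Additive.ofMul u) = -Φ (Additive.ofMul (Units.map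
      (Field.absoluteGaloisGroup.toAlgEquiv (v.adicCompletion ℚ) σ :
        AlgebraicClosure (v.adicCompletion ℚ) →* AlgebraicClosure (v.adicCompletion ℚ)) u)))
  {q : v.adicCompletion ℚ} (hq0 : q ≠ 0) (hq1 : Valued.v q < 1)
  (hker : ∀ u : (AlgebraicClosure (v.adicCompletion ℚ))ˣ, Φ (Additive.ofMul u) = 0 →
    ∃ a : ℤ, (u : AlgebraicClosure (v.adicCompletion ℚ)) =
      algebraMap (v.adicCompletion ℚ) (AlgebraicClosure (v.adicCompletion ℚ)) q ^ a)
  (hΦI : ∀ σ ∈ absInertia (v.adicCompletion ℚ), ∀ u : (AlgebraicClosure (v.adicCompletion ℚ))ˣ,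
    σ • Φ (Additive.ofMul u) = Φ (Additive.ofMul (Units.map
      (Field.absoluteGaloisGroup.toAlgEquiv (v.adicCompletion ℚ) σ :
        AlgebraicClosure (v.adicCompletion ℚ) →* AlgebraicClosure (v.adicCompletion ℚ)) u)))

/-! ## §1. Points of `C[p]` are parametrised by `p`-th roots of unity -/

omit [W.IsElliptic] hp in
include hq0 hq1 hker in
/-- A `p`-torsion point of the Tate datum is `Φ(ζ)` with `ζ ∈ μ_p`: if `ι c = Φ(ζ)` (`ζ` of finite
order) and `p•c = 0` then `ζ^p ∈ q^ℤ` is a root of unity, hence `ζ^p = 1` (`0 < |q|_v < 1`).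
[cite: SilvermanATAEC1994, Ch. V Thm. 3.1 (c),(d)] -/
theorem exists_pow_eq_one_of_mem (c : W.geomPrimaryTorsion p) (hc : c ∈ (tateDatum W p Φ hΦ).plus)
    (hpc : p • c = 0) :
    ∃ ζ : (AlgebraicClosure (v.adicCompletion ℚ))ˣ, ζ ^ p = 1 ∧
      Φ (Additive.ofMul ζ) = pointsMap W (v.adicCompletion ℚ) (c : W.geomPoints) := by
  obtain ⟨ζ, hζfin, hζc⟩ := hc
  refine ⟨ζ, ?_, hζc⟩
  have h0 : Φ (Additive.ofMul (ζ ^ p)) = 0 := by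
    rw [ofMul_pow, map_nsmul, hζc, ← map_nsmul, hpc, map_zero]
  obtain ⟨a, ha⟩ := hker _ h0
  obtain ⟨n, hn, hζn⟩ := isOfFinOrder_iff_pow_eq_one.1 hζfin
  have h1 : algebraMap (v.adicCompletion ℚ) (AlgebraicClosure (v.adicCompletion ℚ)) q ^
      (a * n) = 1 := by
    rw [zpow_mul, ← ha, zpow_natCast, ← Units.val_pow_eq_pow_val, ← pow_mul, mul_comm, pow_mul,
      hζn, one_pow, Units.val_one]
  have h2 : a * n = 0 := WeierstrassCurve.zpow_algebraMap_eq_one_imp v hq0 hq1 h1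
  have ha0 : a = 0 := by
    rcases mul_eq_zero.mp h2 with h | h
    · exact h
    · exact absurd h (by exact_mod_cast hn.ne')
  rw [ha0, zpow_zero] at ha
  exact Units.ext ha

omit [W.IsElliptic] in
include hq0 hq1 hker hΦI in
/-- **Inertia acts on `C[p]` through the mod-`p` cyclotomic character**: if `σ ∈ I_{ℚ_v}` has
`χ_p(σ) = N` (`N < p` a natural number), then `res σ • c = N • c` for every `p`-torsion point `c` of
the Tate datum (`ι c = Φ(ζ)`, `σζ = ζ^N`). GV p. 14: "`C ≅ μ_{p^∞}`" as an `I_p`-module.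
[cite: GreenbergVatsal2000, §2 pp. 14–15] -/
theorem smul_eq_nsmul_of_cyclotomicCharacter_eq {σ : absoluteGaloisGroup (v.adicCompletion ℚ)}
    (hσ : σ ∈ absInertia (v.adicCompletion ℚ)) {N : ℕ} (hN : N < p)
    (hχ : ((GaloisRep.cyclotomicCharacter (v.adicCompletion ℚ) p σ : ℤ_[p]ˣ) : ℤ_[p]) = N)
    (c : W.geomPrimaryTorsion p) (hc : c ∈ (tateDatum W p Φ hΦ).plus) (hpc : p • c = 0) :
    absGaloisRestrict ℚ (v.adicCompletion ℚ) σ • c = N • c := by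
  haveI : NeZero ((p : ℕ) : v.adicCompletion ℚ) := ⟨by
    rw [← map_natCast (algebraMap ℚ (v.adicCompletion ℚ))]
    exact (map_ne_zero_iff _ (algebraMap ℚ (v.adicCompletion ℚ)).injective).mpr
      (Nat.cast_ne_zero.mpr hp.out.ne_zero)⟩
  obtain ⟨ζ, hζp, hζc⟩ := exists_pow_eq_one_of_mem W p Φ hΦ hq0 hq1 hker c hc hpc
  have hζp' : (ζ : AlgebraicClosure (v.adicCompletion ℚ)) ^ p ^ 1 = 1 := by
    rw [pow_one, ← Units.val_pow_eq_pow_val, hζp, Units.val_one]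
  have hσζ : σ • (ζ : AlgebraicClosure (v.adicCompletion ℚ)) = (ζ : _) ^ N := by
    rw [GaloisRep.cyclotomicCharacter_spec (v.adicCompletion ℚ) p σ _ hζp', hχ, map_natCast,
      ZMod.val_natCast, pow_one, Nat.mod_eq_of_lt hN]
  have hunit : Units.map (Field.absoluteGaloisGroup.toAlgEquiv (v.adicCompletion ℚ) σ :
      AlgebraicClosure (v.adicCompletion ℚ) →* AlgebraicClosure (v.adicCompletion ℚ)) ζ = ζ ^ N := by
    ext
    rw [Units.coe_map, MonoidHom.coe_coe, ← Field.absoluteGaloisGroup.smul_def, hσζ,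
      Units.val_pow_eq_pow_val]
  -- compare in `E(K̄_v)`
  apply Subtype.ext
  apply pointsMapOfEmb_injective W (closureEmb (K := ℚ) (v.adicCompletion ℚ))
  change pointsMap W (v.adicCompletion ℚ)
      (absGaloisRestrict ℚ (v.adicCompletion ℚ) σ • (c : W.geomPoints)) =
    pointsMap W (v.adicCompletion ℚ) (((N • c : W.geomPrimaryTorsion p)) : W.geomPoints)
  rw [AddSubmonoidClass.coe_nsmul, map_nsmul, ← hζc, ← map_nsmul, ← ofMul_pow, ← hunit,
    ← hΦI σ hσ ζ, hζc]
  exact pointsMap_smul W (v.adicCompletion ℚ) σ (c : W.geomPoints)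

/-- For an odd prime `p` and `N` prime to `p` there is `σ` in the local inertia group of `ℚ_v`
(`v ∋ p`) with `χ_p(σ) = N` (local Kronecker–Weber: `χ_p(I_{ℚ_p}) = ℤ_p^×`, tree theorem
`adicCompletion_rat_exists_mem_absInertia_cyclotomicCharacter_eq`).
[cite: SerreLocalFields1979, Ch. IV §4 Prop. 17] -/
theorem exists_mem_absInertia_cyclotomicCharacter_eq_natCast (hpv : ((p : ℕ) : 𝓞 ℚ) ∈ v.asIdeal)
    {N : ℕ} (hN : ¬ p ∣ N) :
    ∃ σ ∈ absInertia (v.adicCompletion ℚ),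
      ((GaloisRep.cyclotomicCharacter (v.adicCompletion ℚ) p σ : ℤ_[p]ˣ) : ℤ_[p]) = N := by
  have hunit : IsUnit ((N : ℕ) : ℤ_[p]) := by
    rw [PadicInt.isUnit_iff]
    refine le_antisymm (PadicInt.norm_le_one _) (not_lt.mp fun hlt ↦ ?_)
    have hlt' : ‖(((N : ℕ) : ℤ) : ℤ_[p])‖ < 1 := by exact_mod_cast hlt
    have hdvd : (p : ℤ) ∣ ((N : ℕ) : ℤ) := (PadicInt.norm_int_lt_one_iff_dvd _).mp hlt'
    exact hN (by exact_mod_cast hdvd)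
  have hvp : (Rat.HeightOneSpectrum.primesEquiv v : ℕ) = p :=
    Rat.HeightOneSpectrum.primesEquiv_eq_of_natCast_mem v hp.out hpv
  obtain ⟨σ, hσ, hχ⟩ :=
    adicCompletion_rat_exists_mem_absInertia_cyclotomicCharacter_eq p v hvp hunit.unit
  exact ⟨σ, hσ, by rw [hχ, IsUnit.unit_spec]⟩

/-! ## §2. `hgen`: inertia moves every point of `C[p]` -/

omit [W.IsElliptic] in
include hq0 hq1 hker hΦI in
/-- **`hgen` for the Tate datum at an odd `p ‖ N` of `E/ℚ`**: every `c ∈ C_v ∩ E[p^∞][p]` is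
`τ•c' − c'` with `τ ∈ I_v`, `c' ∈ C_v ∩ E[p^∞][p]` (`τ = res σ₀` with `χ_p(σ₀) = 2`, `c' = c`:
`σ₀` acts on `C[p] = Φ(μ_p)` as `2`). The hypothesis `hgen` of the intrinsic transfer
(`GreenbergVatsalTorsionInvariants.natCard_gvSelmer_inf_torsion_eq_of_inertia`) for the
MULTIPLICATIVE member of a route-G pair. [cite: GreenbergVatsal2000, §2 pp. 14–15 and p. 26] -/
theorem tateDatum_hgen (hp2 : p ≠ 2) (hpv : ((p : ℕ) : 𝓞 ℚ) ∈ v.asIdeal) :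
    ∀ c ∈ (torsionDatum (tateDatum W p Φ hΦ) p).plus, ∃ τ ∈ inertia v,
      ∃ c' ∈ (torsionDatum (tateDatum W p Φ hΦ) p).plus, τ • c' - c' = c := by
  intro c hc
  have hpp : 2 < p := lt_of_le_of_ne hp.out.two_le (Ne.symm hp2)
  obtain ⟨σ₀, hσ₀I, hχ⟩ := exists_mem_absInertia_cyclotomicCharacter_eq_natCast p hpv (N := 2)
    (fun h ↦ hp2 ((Nat.prime_dvd_prime_iff_eq hp.out Nat.prime_two).mp h))
  refine ⟨absGaloisRestrict ℚ (v.adicCompletion ℚ) σ₀, Subgroup.mem_map_of_mem _ hσ₀I, c, hc, ?_⟩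
  have hcC : (c : W.geomPrimaryTorsion p) ∈ (tateDatum W p Φ hΦ).plus := hc
  have hpc : p • (c : W.geomPrimaryTorsion p) = 0 := AddSubgroup.torsionBy.nsmul_iff.mp c.2
  have h2 := smul_eq_nsmul_of_cyclotomicCharacter_eq W p Φ hΦ hq0 hq1 hker hΦI hσ₀I hpp hχ _ hcC hpc
  apply Subtype.ext
  change absGaloisRestrict ℚ (v.adicCompletion ℚ) σ₀ • (c : W.geomPrimaryTorsion p) -
      (c : W.geomPrimaryTorsion p) = (c : W.geomPrimaryTorsion p)
  rw [h2, two_nsmul, add_sub_cancel_right]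

/-! ## §3. `E(ℚ_∞)[p^∞] = E(ℚ)[p^∞]` at an odd `p ‖ N`, `κ` cyclotomic (Mazur 6.12 at a Tate prime) -/

include hΦ hq0 hq1 hker hΦI in
/-- **The local inertia group acts trivially on `B = E[p^∞]^{Gal(ℚ̄/ℚ_∞)}`** for ANY
`ℤ_p`-extension `κ` of `ℚ`, `p` odd, at a place `v ∋ p` carrying a Tate parametrisation: (i) on
`B[p] ∩ C` an inertia element `τ₀` with `χ_p(τ₀) = p − 1` acts as `−1`, but `Γ_ℚ` acts on the
finite set `B[p]` through a finite quotient of `Γ_ℚ/ker κ ≅ ℤ_p`, a `p`-GROUP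
(`ZpExtension.isPGroup_range_of_kerSubgroup_le`), so `τ₀^{p^a}` fixes `B[p]` while acting as
`(−1)^{p^a} = −1` on `B[p] ∩ C` — hence `B ∩ C[p] = 0` and `B ∩ C = 0`; (ii) for `τ` in the inertia
group and `b ∈ B`, `τb − b ∈ B ∩ C` (`tateDatum_htriv`) `= 0`. The argument of the tree's
`smul_eq_of_mem_inertia_of_mem_fixedPoints_kerSubgroup` (good ordinary, Serre's line) run on the
Tate line. [cite: GreenbergLNM1716, §1 p. 62; §3 p. 86] [cite: GreenbergVatsal2000, §2 pp. 14–15] -/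
theorem smul_eq_of_mem_absInertia_of_mem_fixedPoints (κ : ZpExtension ℚ p) (hp2 : p ≠ 2)
    (hpv : ((p : ℕ) : 𝓞 ℚ) ∈ v.asIdeal) (hsurj : Function.Surjective Φ)
    {τ : absoluteGaloisGroup (v.adicCompletion ℚ)} (hτ : τ ∈ absInertia (v.adicCompletion ℚ))
    {b : W.geomPrimaryTorsion p}
    (hb : b ∈ FixedPoints.addSubgroup κ.kerSubgroup (W.geomPrimaryTorsion p)) :
    absGaloisRestrict ℚ (v.adicCompletion ℚ) τ • b = b := by
  have hpr : p.Prime := hp.out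
  have hp' : Odd p := hpr.eq_two_or_odd'.resolve_left hp2
  have hpp : 2 < p := lt_of_le_of_ne hpr.two_le (Ne.symm hp2)
  set B := FixedPoints.addSubgroup κ.kerSubgroup (W.geomPrimaryTorsion p) with hB
  set C := (tateDatum W p Φ hΦ).plus with hC
  -- an inertia element acting as `-1` on `C[p]`
  obtain ⟨τ₀, hτ₀I, hχ₀⟩ := exists_mem_absInertia_cyclotomicCharacter_eq_natCast p hpv (N := p - 1)
    (fun h ↦ by
      have h1 : p ≤ p - 1 := Nat.le_of_dvd (by omega) h
      omega)
  have hneg : ∀ m : W.geomPrimaryTorsion p, m ∈ C → p • m = 0 →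
      absGaloisRestrict ℚ (v.adicCompletion ℚ) τ₀ • m = -m := by
    intro m hmC hpm
    rw [smul_eq_nsmul_of_cyclotomicCharacter_eq W p Φ hΦ hq0 hq1 hker hΦI hτ₀I (Nat.sub_lt hpr.pos
      one_pos) hχ₀ m hmC hpm, eq_neg_iff_add_eq_zero, ← succ_nsmul, Nat.sub_add_cancel hpr.one_le, hpm]
  -- (i) `B ∩ C[p] = 0`
  have hBCp : ∀ m : W.geomPrimaryTorsion p, m ∈ B → m ∈ C → p • m = 0 → m = 0 := by
    intro m₀ hm₀B hm₀C hpm₀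
    by_contra hm₀ne
    set V : AddSubgroup (W.geomPrimaryTorsion p) := B ⊓ (W.geomPrimaryTorsion p)[(p : ℕ)] with hV
    have hfinp : Finite ↥((W.geomPrimaryTorsion p)[(p : ℕ)]) := by
      have h := W.finite_torsionBy_geomPrimaryTorsion p 1
      rwa [pow_one] at h
    haveI hVfin : Finite V :=
      Finite.of_injective _ (AddSubgroup.inclusion_injective (inf_le_right : V ≤ _))
    have hmemV : ∀ {w : W.geomPrimaryTorsion p}, w ∈ V ↔ w ∈ B ∧ p • w = 0 := by
      intro w
      rw [hV, AddSubgroup.mem_inf, AddSubgroup.torsionBy.nsmul_iff]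
    have hstab : ∀ (σ : absoluteGaloisGroup ℚ) (w : W.geomPrimaryTorsion p), w ∈ V → σ • w ∈ V := by
      intro σ w hw
      rw [hmemV] at hw ⊢
      refine ⟨W.smul_mem_fixedPoints_kerSubgroup κ σ hw.1, ?_⟩
      rw [smul_comm, hw.2, smul_zero]
    let ρ : absoluteGaloisGroup ℚ →* Equiv.Perm V :=
      { toFun := fun σ ↦
          { toFun := fun w ↦ ⟨σ • (w : W.geomPrimaryTorsion p), hstab σ _ w.2⟩
            invFun := fun w ↦ ⟨σ⁻¹ • (w : W.geomPrimaryTorsion p), hstab σ⁻¹ _ w.2⟩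
            left_inv := fun w ↦ Subtype.ext (inv_smul_smul σ (w : W.geomPrimaryTorsion p))
            right_inv := fun w ↦ Subtype.ext (smul_inv_smul σ (w : W.geomPrimaryTorsion p)) }
        map_one' := Equiv.ext fun w ↦ Subtype.ext (one_smul _ (w : W.geomPrimaryTorsion p))
        map_mul' := fun σ σ' ↦ Equiv.ext fun w ↦
          Subtype.ext (mul_smul σ σ' (w : W.geomPrimaryTorsion p)) }
    have hρ : ∀ (σ : absoluteGaloisGroup ℚ) (w : V),
        ((ρ σ w : V) : W.geomPrimaryTorsion p) = σ • (w : W.geomPrimaryTorsion p) := fun _ _ ↦ rfl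
    have hkerρ : κ.kerSubgroup ≤ ρ.ker := by
      intro σ hσ
      rw [MonoidHom.mem_ker]
      refine Equiv.ext fun w ↦ Subtype.ext ?_
      rw [hρ, Equiv.Perm.coe_one, id_eq]
      have h := (FixedPoints.mem_addSubgroup _ _ _).mp (hmemV.mp w.2).1 ⟨σ, hσ⟩
      rwa [Subgroup.mk_smul] at h
    have hP : IsPGroup p ρ.range := κ.isPGroup_range_of_kerSubgroup_le ρ hkerρ
    set t₀ : absoluteGaloisGroup ℚ := absGaloisRestrict ℚ (v.adicCompletion ℚ) τ₀ with ht₀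
    have hm₀V : m₀ ∈ V := hmemV.mpr ⟨hm₀B, hpm₀⟩
    obtain ⟨a, ha⟩ := hP ⟨ρ t₀, MonoidHom.mem_range.mpr ⟨t₀, rfl⟩⟩
    have ha' : ρ (t₀ ^ p ^ a) = 1 := by
      have h := congrArg Subtype.val ha
      rwa [SubmonoidClass.coe_pow, ← map_pow] at h
    have h1 : (t₀ ^ p ^ a) • m₀ = m₀ := by
      have h := congrArg (fun π : Equiv.Perm V ↦ ((π ⟨m₀, hm₀V⟩ : V) : W.geomPrimaryTorsion p)) ha'
      simpa only [hρ, Equiv.Perm.coe_one, id_eq] using h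
    have hτ₀m₀ : t₀ • m₀ = -m₀ := hneg m₀ hm₀C hpm₀
    have h2 : ∀ k : ℕ, (t₀ ^ k) • m₀ = ((-1 : ℤ) ^ k) • m₀ := by
      intro k
      induction k with
      | zero => rw [pow_zero, pow_zero, one_smul, one_zsmul]
      | succ k ih =>
        rw [pow_succ, mul_smul, hτ₀m₀, smul_neg, ih, pow_succ, mul_neg_one, neg_zsmul]
    have h3 : (t₀ ^ p ^ a) • m₀ = -m₀ := by
      rw [h2, (hp'.pow).neg_one_pow, neg_one_zsmul]
    have h4 : 2 • m₀ = 0 := by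
      rw [two_nsmul]
      exact eq_neg_iff_add_eq_zero.mp (h1.symm.trans h3)
    exact hm₀ne (eq_zero_of_two_nsmul_eq_zero_of_odd hp' h4 hpm₀)
  -- (ii) `B ∩ C = 0`
  have hBC : ∀ c : W.geomPrimaryTorsion p, c ∈ B → c ∈ C → c = 0 := by
    intro c hcB hcC
    by_contra hc0
    obtain ⟨j, hne, hpj⟩ := W.exists_pow_smul_ne_zero_and_p_smul_eq_zero hc0
    exact hne (hBCp _ (B.nsmul_mem hcB _) (C.nsmul_mem hcC _) hpj)
  -- (iii) `τ b - b ∈ B ∩ C`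
  have hd : absGaloisRestrict ℚ (v.adicCompletion ℚ) τ • b - b ∈ B :=
    B.sub_mem (W.smul_mem_fixedPoints_kerSubgroup κ _ hb) hb
  have hdC : absGaloisRestrict ℚ (v.adicCompletion ℚ) τ • b - b ∈ C :=
    tateDatum_htriv W p Φ hΦ hsurj hker hΦI _ (Subgroup.mem_map_of_mem _ hτ) b
  exact sub_eq_zero.mp (hBC _ hd hdC)

include hΦ hq0 hq1 hker hΦI in
/-- **`E(ℚ_∞)[p^∞] = E(ℚ)[p^∞]` at an odd prime carrying a Tate parametrisation, for the CYCLOTOMIC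
`ℤ_p`-extension**: every `σ ∈ Γ_ℚ` fixes `B = E[p^∞]^{Gal(ℚ̄/ℚ_∞)}` — write `σ = τ(τ⁻¹σ)` with `τ` in
the inertia group of the place (`= res I_{ℚ_v}`, `inertia_adicCompletionPrime_eq_map_absInertia`) and
`τ⁻¹σ ∈ ker κ` (`ℚ_∞/ℚ` totally ramified at `p`,
`ZpExtension.IsCyclotomic.exists_mem_inertia_inv_mul_mem_kerSubgroup`). GV p. 26: "`E(ℚ_∞)_{tors}`
is known to be finite". [cite: GreenbergLNM1716, §1 p. 62; §3 p. 86] [cite: GreenbergVatsal2000, §2 p. 26] -/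
theorem smul_eq_of_mem_fixedPoints_kerSubgroup (κ : ZpExtension ℚ p) (hκ : κ.IsCyclotomic)
    (hp2 : p ≠ 2) (hpv : ((p : ℕ) : 𝓞 ℚ) ∈ v.asIdeal) (hsurj : Function.Surjective Φ)
    (σ : absoluteGaloisGroup ℚ) {b : W.geomPrimaryTorsion p}
    (hb : b ∈ FixedPoints.addSubgroup κ.kerSubgroup (W.geomPrimaryTorsion p)) : σ • b = b := by
  have hvp : (Rat.HeightOneSpectrum.primesEquiv v : ℕ) = p :=
    Rat.HeightOneSpectrum.primesEquiv_eq_of_natCast_mem v hp.out hpv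
  obtain ⟨τ, hτ, hk⟩ := hκ.exists_mem_inertia_inv_mul_mem_kerSubgroup hvp
    (adicCompletionPrime_mem_primesAbove ℚ v) σ
  rw [inertia_adicCompletionPrime_eq_map_absInertia] at hτ
  obtain ⟨τ', hτ', rfl⟩ := Subgroup.mem_map.mp hτ
  have h1 : ((absGaloisRestrict ℚ (v.adicCompletion ℚ)).toMonoidHom τ')⁻¹ * σ ∈ κ.kerSubgroup := hk
  have h2 : (((absGaloisRestrict ℚ (v.adicCompletion ℚ)).toMonoidHom τ')⁻¹ * σ) • b = b := by
    have h := (FixedPoints.mem_addSubgroup _ _ _).mp hb ⟨_, h1⟩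
    rwa [Subgroup.mk_smul] at h
  calc σ • b = ((absGaloisRestrict ℚ (v.adicCompletion ℚ)).toMonoidHom τ') •
        ((((absGaloisRestrict ℚ (v.adicCompletion ℚ)).toMonoidHom τ')⁻¹ * σ) • b) := by
          rw [← mul_smul, mul_inv_cancel_left]
    _ = (absGaloisRestrict ℚ (v.adicCompletion ℚ)).toMonoidHom τ' • b := by rw [h2]
    _ = b := smul_eq_of_mem_absInertia_of_mem_fixedPoints W p Φ hΦ hq0 hq1 hker hΦI κ hp2 hpv hsurj
        hτ' hb

include hΦ hq0 hq1 hker hΦI in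
/-- **`B = E(ℚ_∞)[p^∞]` is finite** at an odd prime carrying a Tate parametrisation, for the
cyclotomic `ℤ_p`-extension (it equals `E(ℚ)[p^∞]`; `E(ℚ)_{tors}` is finite, tree
`finite_fixedPoints_geomPrimaryTorsion`) — the hypothesis `[Finite (invariants H M)]` of the kernel
comparison theorems for the multiplicative member. [cite: GreenbergLNM1716, §1 p. 62; §3 p. 86] -/
theorem finite_fixedPoints_kerSubgroup (κ : ZpExtension ℚ p) (hκ : κ.IsCyclotomic)
    (hp2 : p ≠ 2) (hpv : ((p : ℕ) : 𝓞 ℚ) ∈ v.asIdeal) (hsurj : Function.Surjective Φ) :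
    Finite (FixedPoints.addSubgroup κ.kerSubgroup (W.geomPrimaryTorsion p)) := by
  have hfin := W.finite_fixedPoints_geomPrimaryTorsion p
  have hsub : ((FixedPoints.addSubgroup κ.kerSubgroup (W.geomPrimaryTorsion p) :
      AddSubgroup (W.geomPrimaryTorsion p)) : Set (W.geomPrimaryTorsion p)) ⊆
      {m | ∀ σ : absoluteGaloisGroup ℚ, σ • m = m} :=
    fun m hm σ ↦ smul_eq_of_mem_fixedPoints_kerSubgroup W p Φ hΦ hq0 hq1 hker hΦI κ hκ hp2 hpv
      hsurj σ hm
  exact (hfin.subset hsub).to_subtype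

end Summit.BirchSwinnertonDyer.Rank1Residual.X2.GreenbergVatsalTateDatumTorsion

end
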